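import Literature.MathematicalPhysics.QuantumFieldTheory.Balaban1983to89.B6Eq2130TwoScaleV1Landau
import Literature.MathematicalPhysics.QuantumFieldTheory.Balaban1983to89.B5Eq119TorusBridge
import Literature.MathematicalPhysics.QuantumFieldTheory.Balaban1983to89.B5Eq166GaussDeltaK

/-!
# `Balaban1983to89.B6Ineq2118TwoScaleV1` — T. Bałaban, *Propagators and renormalization transformations for lattice gauge
# theories. II*, Commun. Math. Phys. **96** (1984) 223–250 [Balaban1984PropagatorsII], p. 243 (2.118), p. 244 (2.120), p. 246, p. 248
# (2.147), with [4] = T. Bałaban, *… I*, Commun. Math. Phys. **95** (1984) 17–40 [Balaban1984PropagatorsI] p. 29 (1.67), p. 34 (1.100)–(1.101):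
# **THE INEQUALITY (2.118) `γ₀‖∂₁B‖² ≤ ⟨B, Δ_jB⟩ ≤ γ₁‖∂₁B‖²` FOR THE CONCRETE TWO-SCALE OPERATOR `Δ_j` OF THE V1 DATA `tsV1`**, and its
# printed consequence: the form (2.120) *"is bounded from above"* — i.e. the one-level lower bound `Q_jG_jQ_j* ≥ γ` — UNCONDITIONALLY for `tsV1`

statement-level skeleton of published theorems with citation tags; proofs where landed; nothing here is a claim about the Yang–Mills mass gap

PDF held: `paper:balaban1984-cmp96-propagators-rt-ii` (journal page = PDF page + 222; pp. 243–248 [PDF 21–26], materialised text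
`~/.lit/texts/…-rt-ii/p0021.txt … p0026.txt`, this session) and `paper:balaban1984-cmp95-propagators-rt-i` (pp. 29, 34 [PDF 13, 18], text layer).

PRINT (verbatim, text layer).  [B6] p. 243: *"the quadratic forms are equal to ⟨B, Δ_jB⟩ given by (1.66) and satisfying (1.67):
γ₀‖∂₁B‖² ≦ ⟨B, Δ_jB⟩ ≦ γ₁‖∂₁B‖². (2.118)"*; p. 244: *"(we take a = 1) ‖B↾_{Λ^c}‖² + L^{−2}‖(Q₁B)↾_{Λ′}‖² + ⟨B, Δ_jB⟩ (2.120) … The form is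
bounded from above, and bounded from below by ‖B↾_{Λ^c}‖². There is also the bound (2.118)"*; p. 246: *"They follow from the Proposition 1.2
and from the formulas and the inequalities (1.99)–(1.101) for Q_jG_jQ_j*."*; p. 248: *"The operator C̃ is an inverse to the operator of the
quadratic form (2.120), hence it is bounded from below by an inverse of an upper bound of this form."*  [B5] p. 29: *"… bounded from below
and above by positive constants γ₀, γ₁ dependent on d only, so we have γ₀⟨∂₁B, ∂₁B⟩ ≦ ⟨B, Δ_kB⟩ ≦ γ₁⟨∂₁B, ∂₁B⟩. (1.67)"*; p. 34: *"it is bounded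
from below and above by positive constants dependent on d only (for a = 1). The same property holds for QGQ*."*.

CITATION HEADER (lean-in-tree rule) — WHAT IS REPRODUCED.  Phase-2 file of the `lit-balaban` typed skeleton (HOME
`run/shared/lean/pub/lit-balaban/`), seat **p22 gen 10** (B6 fold owner r03, referee ref-4; lane = the Sect. C chain (2.95)–(2.147) on the
concrete two-scale data `…B6SectCTwoScaleV1Lattice.tsV1`).  SKELETON rows **B6.Eq2.118** (head proved-existing for the (1.66) form,
`…B5Bounds167Lattice.ineq167` + edge `…B6.h2118_of_B5` — untouched), **B6.Eq2.120** / **B6.Txt@246** (gen 9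
`…B6Eq2118DeltaJInverse.inner_Sb_le_of_QGQ_ge`/`inner_Ej_le_of_QGQ_ge` REDUCED p. 244 *"bounded from above"* and the p. 248 C̃-sentence to a
displayed hypothesis `hlow : γ‖ω‖² ≤ ⟨ω, Q_jG_jQ_j*ω⟩`), **B6.Eq2.144** ((2.147) side), knitted with **B5.Eq1.67**
(`…B5Eq166GaussDeltaK.ineq167_DeltaK_sharp`, p21) and **B5.Eq1.19** (`…B5Eq119TorusBridge.dotProduct_DeltaK_eq_inner_DeltaK`, p16), FOR THE
CONCRETE `D = tsV1 hc Λ′ w` (fine torus `T^{(0)}` with factor `c ≠ 0`, unit lattice `T^{(j)}`, `j + 1 ≤ m + K`, `Λ′ ⊂ T^{(j+1)}`, weights `w > 0`):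
* §1 (abstract `TwoScaleData`, converse of gen 9's reduction): an UPPER bound `⟨b, (Q_jG_jQ_j*)⁻¹b⟩ ≤ C‖b‖²` gives the LOWER bound
  **`C⁻¹‖ω‖² ≤ ⟨ω, Q_jG_jQ_j*ω⟩`** (`inner_QGQ_ge_of_Ej_le`, Cauchy–Schwarz for the positive form `(Q_jG_jQ_j*)⁻¹`; `inner_QGQ_ge_of_Δj_le`);
* §2 (V1 calculus): the (1.19) form scales with the action, `B⬝Δ_k^{V1}(w, c)B = w·c²·B⬝Δ_k^{V1}(1, 1)B` (`form_DeltaK_scale`, `IsLeast`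
  uniqueness on p16's `…B5Eq165GaugeMinimaV1.isLeast_curlAction_avgFibre` and `…B5Eq147TorusBridge.curlAction_eq_mul`);
* §3 (unit torus): `‖∂₁B‖² ≤ 8d‖B‖²` (`d1Sq_le`), hence **`⟨B, Δ_kB⟩ ≤ 8dγ₁‖B‖²`** for the Gaussian `Δ_k` of (1.19) (`inner_DeltaK_le_norm_sq`);
* §4 with gen 9's `inner_Δj_eq_DeltaK`: **`⟨B, Δ_jB⟩_{tsV1} = κ·⟨B̃, Δ_j^{tower}B̃⟩`, `κ = c²/(η^d L^{2j})`, `η = L^{−j}`** (`inner_Δj_eq_tower`: the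
  (2.118) form of `tsV1` IS the B5 owner's Gaussian `Δ_j` of (1.19)/(1.65)/(1.66), `…B5Eq114Gauss.DeltaK L (Mk P j) j`, up to the model
  normalisation `κ`; `κ = 1` at the printed normalisation `c² = η^{d−2} = η^d·L^{2j}`); **(2.118) FOR `tsV1`: `κ‖∂₁B‖² ≤ ⟨B, Δ_jB⟩ ≤ κγ₁‖∂₁B‖²`**
  (`ineq2118_V1`; `‖∂₁B‖² = …B5Bounds167Lattice.d1Sq`, the (1.66)/(1.67) object of record; `γ₁ = (π²/4)^{d+2}`); `⟨B, Δ_jB⟩ ≤ 8dγ₁κ‖B‖²`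
  (`inner_Δj_le_V1`), `⟨B, (Q_jG_jQ_j*)⁻¹B⟩ ≤ (1 + 8dγ₁κ)‖B‖²` (`inner_Ej_le_V1`), and **THE DISCHARGE `(1 + 8dγ₁κ)⁻¹‖ω‖² ≤ ⟨ω, Q_jG_jQ_j*ω⟩`
  for every `ω` on `T^{(j)}`** (`inner_QGQ_ge_V1`) — gen 9's `hlow` holds for the concrete model; so p. 244 *"The form is bounded from above"*:
  **`⟨B, (Q″*aQ″ + Δ_j)B⟩ ≤ ⟨Q″B, aQ″B⟩ + 8dγ₁κ‖B‖²` with NO displayed hypothesis** (`inner_Sb_le_V1`; verbatim through gen 9's reduction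
  `inner_Sb_le_V1'`, `inner_Ej_le_V1'`); at the printed normalisation the constants depend on `d` only (`ineq2118_V1_printed`,
  `inner_QGQ_ge_V1_printed`, `inner_Sb_le_V1_printed`).
ROUTE (honest): print (p. 246) derives the `Q_jG_jQ_j*` bounds from [4] (1.99)–(1.101) (proved on r02's torus carriers by p09's
`…B5Ineq1101QGQTorus.re_form_QGQ_ge`); THIS FILE takes the p. 248 road — the upper bound of the (2.120) form through (2.118)'s `γ₁` ([4] (1.67),
p21) and `(Q_jG_jQ_j*)⁻¹ = I + Δ_j` (gen 9) — so no V1 ↔ `B5DeltaA169` dictionary is needed.  THEOREMS ONLY (no definition, no `def … : Prop`,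
nothing is a named unproved fact; standard axioms).  HONEST SCOPE: the finite-dimensional `ℓ²` model `tsV1` (weight `a = 1` on `Q_j*Q_j`);
the constants `γ₁ = (π²/4)^{d+2}` (`Beta.Ineq167OperatorUpper.gamma1`) and `8d` are OURS — print says only *"positive constants dependent on d
only"*; the LOWER bound of (2.120)/(2.122) (Lemma 2.4, rows B6.Lem2.4 / B6.Eq2.152) is NOT touched; NOT summit progress.
-/

noncomputable section

open scoped InnerProductSpace Matrix BigOperators

namespace Literature.MathematicalPhysics.QuantumFieldTheory.Balaban1983to89.B6Ineq2118TwoScaleV1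

/-! ## §1  Abstract: an upper bound of `(Q_jG_jQ_j*)⁻¹` is a lower bound of `Q_jG_jQ_j*` -/

section Abstract

open B6CovarianceOperator B6SectCOperators B6SectCOperators.TwoScaleData B6SectCPositivity B6Eq2118DeltaJInverse

variable {A B W T Bs V : Type*}
  [NormedAddCommGroup A] [InnerProductSpace ℝ A] [FiniteDimensional ℝ A]
  [NormedAddCommGroup B] [InnerProductSpace ℝ B] [FiniteDimensional ℝ B]
  [NormedAddCommGroup W] [InnerProductSpace ℝ W] [FiniteDimensional ℝ W]
  [NormedAddCommGroup T] [InnerProductSpace ℝ T] [FiniteDimensional ℝ T]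
  [NormedAddCommGroup Bs] [InnerProductSpace ℝ Bs] [FiniteDimensional ℝ Bs]
  [NormedAddCommGroup V] [InnerProductSpace ℝ V] [FiniteDimensional ℝ V]
  {D : TwoScaleData A B W T Bs V}

/-- `⟨b, (Q_jG_jQ_j*)⁻¹b⟩ ≥ 0` (p. 248 *"hence the inverse is well defined and positive also"*). [cite: Balaban1984PropagatorsII, (2.143) p.248] -/
theorem inner_Ej_nonneg (hL : D.IsLattice) (hP : D.Positive) (b : Bs) : 0 ≤ ⟪b, D.Ej b⟫_ℝ := by
  by_cases hb : b = 0
  · rw [hb, inner_zero_left]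
  · exact (Ej_pos hL hP b hb).le

/-- **p. 248 *"an inverse … is bounded from below by an inverse of an upper bound"*, read for `Q_jG_jQ_j* = ((Q_jG_jQ_j*)⁻¹)⁻¹`** (converse of
gen 9's `…B6Eq2118DeltaJInverse.inner_Ej_le_of_QGQ_ge`): an upper bound `⟨b, (Q_jG_jQ_j*)⁻¹b⟩ ≤ C‖b‖²` gives **`C⁻¹‖ω‖² ≤ ⟨ω, Q_jG_jQ_j*ω⟩`**
(Cauchy–Schwarz for the positive form `(Q_jG_jQ_j*)⁻¹` at `ω` and `b = Q_jG_jQ_j*ω`). [cite: Balaban1984PropagatorsII, p.248 (text before (2.147))] -/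
theorem inner_QGQ_ge_of_Ej_le (hL : D.IsLattice) (hP : D.Positive) {C : ℝ} (hC : 0 < C)
    (hup : ∀ b : Bs, ⟪b, D.Ej b⟫_ℝ ≤ C * ‖b‖ ^ 2) (ω : Bs) :
    C⁻¹ * ‖ω‖ ^ 2 ≤ ⟪ω, (D.Qv ∘ₗ D.Gj ∘ₗ LinearMap.adjoint D.Qv) ω⟫_ℝ := by
  simp only [LinearMap.coe_comp, Function.comp_apply]
  set b := D.Qv (D.Gj (LinearMap.adjoint D.Qv ω)) with hb
  have hE : D.Ej b = ω := by rw [hb]; exact Ej_QGQ hL hP ω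
  have h1 : ⟪ω, D.Ej b⟫_ℝ = ‖ω‖ ^ 2 := by rw [hE, real_inner_self_eq_norm_sq]
  have h2 : ⟪b, D.Ej ω⟫_ℝ = ‖ω‖ ^ 2 := by rw [← Ej_symm hL hP, hE, real_inner_self_eq_norm_sq]
  have h3 : ⟪b, D.Ej b⟫_ℝ = ⟪ω, b⟫_ℝ := by rw [hE, real_inner_comm]
  have h0 := inner_Ej_nonneg hL hP (ω - C • b)
  rw [map_sub, map_smul, inner_sub_left, inner_sub_right, inner_sub_right, real_inner_smul_right, real_inner_smul_left,
    real_inner_smul_left, real_inner_smul_right, h1, h2, h3] at h0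
  have h4 := hup ω
  rw [inv_mul_le_iff₀ hC]
  exact le_of_mul_le_mul_left (by linarith : C * ‖ω‖ ^ 2 ≤ C * (C * ⟪ω, b⟫_ℝ)) hC

/-- … and for `Δ_j = (Q_jG_jQ_j*)⁻¹ − I` (gen 9 `Δj_eq_Ej_sub_id`): an upper bound `⟨b, Δ_jb⟩ ≤ C′‖b‖²` of the (2.118) form gives
`(1 + C′)⁻¹‖ω‖² ≤ ⟨ω, Q_jG_jQ_j*ω⟩`. [cite: Balaban1984PropagatorsII, (2.118) p.243 + p.248] -/
theorem inner_QGQ_ge_of_Δj_le (hL : D.IsLattice) (hP : D.Positive) {C' : ℝ} (hC' : 0 ≤ C')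
    (hup : ∀ b : Bs, ⟪b, D.Δj b⟫_ℝ ≤ C' * ‖b‖ ^ 2) (ω : Bs) :
    (1 + C')⁻¹ * ‖ω‖ ^ 2 ≤ ⟪ω, (D.Qv ∘ₗ D.Gj ∘ₗ LinearMap.adjoint D.Qv) ω⟫_ℝ := by
  refine inner_QGQ_ge_of_Ej_le hL hP (by positivity) (fun b => ?_) ω
  linarith [inner_Δj_eq hL hP b, hup b]

end Abstract

/-! ## §2  V1 calculus: the (1.19) form scales with the action; `⟨B, Δ_jB⟩_{tsV1} = κ·⟨B̃, Δ_j^{tower}B̃⟩` -/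

section Scale

open LatticeFieldCalculus B5Eq119GaussianV1 B5Eq165GaugeMinimaV1
open B5Eq147TorusBridge (curlAction_eq_mul)

variable {P : Params} {k : ℕ}

/-- **the (1.19) form scales with the action**: `B⬝Δ_k^{V1}(w, c)B = w·c²·B⬝Δ_k^{V1}(1, 1)B` — both halves are twice the least action
over `{A : Q_kA = B}` (p16's `isLeast_curlAction_avgFibre`), and the action scales (p16's `curlAction_eq_mul`).
[cite: Balaban1984PropagatorsI, (1.19) p.20 + (1.65) p.29] -/
theorem form_DeltaK_scale (hk : k ≤ P.m + P.K) {w : ℝ} (hw : 0 < w) {c : ℝ} (hc : c ≠ 0) (B : VecField P k ℝ) :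
    B ⬝ᵥ (DeltaK P k w c *ᵥ B) = w * c ^ 2 * (B ⬝ᵥ (DeltaK P k 1 1 *ᵥ B)) := by
  have h1 := isLeast_curlAction_avgFibre hk hw hc B
  have h2 := isLeast_curlAction_avgFibre hk one_pos one_ne_zero B
  have hwc : 0 ≤ w * c ^ 2 := by positivity
  have h3 : IsLeast ((curlAction w c) '' {A : VecField P 0 ℝ | bondAvgIter k A = B})
      (w * c ^ 2 * ((1 / 2) * (B ⬝ᵥ (DeltaK P k 1 1 *ᵥ B)))) := by
    constructor
    · obtain ⟨A, hA, hAval⟩ := h2.1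
      exact ⟨A, hA, by rw [curlAction_eq_mul, hAval]⟩
    · rintro _ ⟨A, hA, rfl⟩
      rw [curlAction_eq_mul]
      exact mul_le_mul_of_nonneg_left (h2.2 ⟨A, hA, rfl⟩) hwc
  linarith [h1.unique h3]

end Scale

/-! ## §3  Unit torus: `‖∂₁B‖² ≤ 8d‖B‖²`, hence `⟨B, Δ_kB⟩ ≤ 8dγ₁‖B‖²` for the Gaussian `Δ_k` of (1.19) -/

section Torus

open B5Prop11Plancherel (Tor unitVec)
open B5Bounds167Lattice (d1Sq)
open B5SectBStatements (Fld cplx)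
open Beta.Ineq167OperatorUpper (gamma1 gamma1_pos)
open B5Eq166GaussDeltaK (ineq167_DeltaK_sharp)

variable {d : ℕ} (M : Fin d → ℕ) [hM : ∀ μ, NeZero (M μ)]

/-- one plaquette: `|(∂₁B)_{μν}(x)|² ≤ 4(|B_ν(x+e_μ)|² + |B_ν(x)|² + |B_μ(x+e_ν)|² + |B_μ(x)|²)`. [cite: Balaban1984PropagatorsI, (1.66) p.29] -/
theorem norm_curl_sq_le (v : Tor M × Fin d → ℂ) (μ ν : Fin d) (x : Tor M) :
    ‖B5Bounds167Lattice.curl M v μ ν x‖ ^ 2 ≤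
      4 * (‖v (x + unitVec M μ, ν)‖ ^ 2 + ‖v (x, ν)‖ ^ 2 + ‖v (x + unitVec M ν, μ)‖ ^ 2 + ‖v (x, μ)‖ ^ 2) := by
  have e : B5Bounds167Lattice.curl M v μ ν x = (v (x + unitVec M μ, ν) - v (x, ν)) - (v (x + unitVec M ν, μ) - v (x, μ)) := by
    simp only [B5Bounds167Lattice.curl, B5Action121.fdiff_mulVec_apply, B5Action121.sdiff_mulVec, B5Action121.comp, one_mul]
  rw [e]
  have hn : ‖(v (x + unitVec M μ, ν) - v (x, ν)) - (v (x + unitVec M ν, μ) - v (x, μ))‖ ≤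
      (‖v (x + unitVec M μ, ν)‖ + ‖v (x, ν)‖) + (‖v (x + unitVec M ν, μ)‖ + ‖v (x, μ)‖) :=
    (norm_sub_le _ _).trans (add_le_add (norm_sub_le _ _) (norm_sub_le _ _))
  have h2 := pow_le_pow_left₀ (norm_nonneg _) hn 2
  nlinarith [h2, sq_nonneg (‖v (x + unitVec M μ, ν)‖ - ‖v (x, ν)‖), sq_nonneg (‖v (x + unitVec M μ, ν)‖ - ‖v (x + unitVec M ν, μ)‖),
    sq_nonneg (‖v (x + unitVec M μ, ν)‖ - ‖v (x, μ)‖), sq_nonneg (‖v (x, ν)‖ - ‖v (x + unitVec M ν, μ)‖),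
    sq_nonneg (‖v (x, ν)‖ - ‖v (x, μ)‖), sq_nonneg (‖v (x + unitVec M ν, μ)‖ - ‖v (x, μ)‖)]

/-- translation invariance of the torus sum. [folklore] -/
private theorem sum_shift (μ : Fin d) (g : Tor M → ℝ) : ∑ x, g (x + unitVec M μ) = ∑ x, g x :=
  Fintype.sum_equiv (Equiv.addRight (unitVec M μ)) _ _ fun _ => rfl

/-- `Σ_μ Σ_ν Σ_x |B_ν(x + e_μ)|² = d·‖B‖²`. [folklore] -/
private theorem sum_sq_shift (v : Tor M × Fin d → ℂ) :
    ∑ μ : Fin d, ∑ ν : Fin d, ∑ x : Tor M, ‖v (x + unitVec M μ, ν)‖ ^ 2 = d * ∑ i, ‖v i‖ ^ 2 := by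
  have h : ∀ μ : Fin d, ∑ ν : Fin d, ∑ x : Tor M, ‖v (x + unitVec M μ, ν)‖ ^ 2 = ∑ i, ‖v i‖ ^ 2 := by
    intro μ
    calc ∑ ν : Fin d, ∑ x : Tor M, ‖v (x + unitVec M μ, ν)‖ ^ 2 = ∑ ν : Fin d, ∑ x : Tor M, ‖v (x, ν)‖ ^ 2 :=
          Finset.sum_congr rfl fun ν _ => sum_shift M μ (fun x => ‖v (x, ν)‖ ^ 2)
      _ = ∑ i, ‖v i‖ ^ 2 := by rw [Fintype.sum_prod_type, Finset.sum_comm]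
  simp_rw [h]
  rw [Finset.sum_const, Finset.card_univ, Fintype.card_fin, nsmul_eq_mul]

/-- `Σ_μ Σ_ν Σ_x |B_ν(x)|² = d·‖B‖²`. [folklore] -/
private theorem sum_sq_noshift (v : Tor M × Fin d → ℂ) :
    ∑ _μ : Fin d, ∑ ν : Fin d, ∑ x : Tor M, ‖v (x, ν)‖ ^ 2 = d * ∑ i, ‖v i‖ ^ 2 := by
  have h : ∑ ν : Fin d, ∑ x : Tor M, ‖v (x, ν)‖ ^ 2 = ∑ i, ‖v i‖ ^ 2 := by
    rw [Fintype.sum_prod_type, Finset.sum_comm]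
  rw [h, Finset.sum_const, Finset.card_univ, Fintype.card_fin, nsmul_eq_mul]

/-- **`‖∂₁B‖² ≤ 8d‖B‖²`** for the unit-lattice curl form `⟨∂₁B, ∂₁B⟩ = ½Σ_{μ,ν}Σ_x|(∂₁B)_{μν}(x)|²` of (1.66)/(1.67) (`…B5Bounds167Lattice.d1Sq`).
[cite: Balaban1984PropagatorsI, (1.66)–(1.67) p.29] -/
theorem d1Sq_le (v : Tor M × Fin d → ℂ) : d1Sq M v ≤ 8 * d * ∑ i, ‖v i‖ ^ 2 := by
  have hS3 : ∑ μ : Fin d, ∑ ν : Fin d, ∑ x : Tor M, ‖v (x + unitVec M ν, μ)‖ ^ 2 = d * ∑ i, ‖v i‖ ^ 2 := by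
    rw [Finset.sum_comm]; exact sum_sq_shift M v
  have hS4 : ∑ μ : Fin d, ∑ ν : Fin d, ∑ x : Tor M, ‖v (x, μ)‖ ^ 2 = d * ∑ i, ‖v i‖ ^ 2 := by
    rw [Finset.sum_comm]; exact sum_sq_noshift M v
  calc d1Sq M v = 1 / 2 * ∑ μ, ∑ ν, ∑ x, ‖B5Bounds167Lattice.curl M v μ ν x‖ ^ 2 := rfl
    _ ≤ 1 / 2 * ∑ μ, ∑ ν, ∑ x,
          4 * (‖v (x + unitVec M μ, ν)‖ ^ 2 + ‖v (x, ν)‖ ^ 2 + ‖v (x + unitVec M ν, μ)‖ ^ 2 + ‖v (x, μ)‖ ^ 2) := by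
        gcongr with μ _ ν _ x _
        exact norm_curl_sq_le M v μ ν x
    _ = 2 * ((∑ μ : Fin d, ∑ ν : Fin d, ∑ x : Tor M, ‖v (x + unitVec M μ, ν)‖ ^ 2)
          + (∑ μ : Fin d, ∑ ν : Fin d, ∑ x : Tor M, ‖v (x, ν)‖ ^ 2)
          + (∑ μ : Fin d, ∑ ν : Fin d, ∑ x : Tor M, ‖v (x + unitVec M ν, μ)‖ ^ 2)
          + (∑ μ : Fin d, ∑ ν : Fin d, ∑ x : Tor M, ‖v (x, μ)‖ ^ 2)) := by
        simp only [Finset.mul_sum, ← Finset.sum_add_distrib]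
        refine Finset.sum_congr rfl fun μ _ => Finset.sum_congr rfl fun ν _ => Finset.sum_congr rfl fun x _ => ?_
        ring
    _ = 8 * d * ∑ i, ‖v i‖ ^ 2 := by rw [sum_sq_shift, sum_sq_noshift, hS3, hS4]; ring

/-- `Σ_i |B̃_i|² = ‖B‖²` for the complexified real field. [folklore] -/
private theorem sum_norm_sq_cplx (B : Fld M) : ∑ i, ‖cplx B i‖ ^ 2 = ‖B‖ ^ 2 := by
  rw [EuclideanSpace.norm_sq_eq]
  refine Finset.sum_congr rfl fun i _ => ?_
  rw [cplx, Complex.norm_real]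

/-- **`⟨B, Δ_kB⟩ ≤ 8dγ₁‖B‖²`** for the Gaussian `Δ_k` of (1.19) on every unit torus, every `k` ((1.67) upper half, p21's
`ineq167_DeltaK_sharp`, `γ₁ = (π²/4)^{d+2}`, and `d1Sq_le`). [cite: Balaban1984PropagatorsI, (1.67) p.29] -/
theorem inner_DeltaK_le_norm_sq (L : ℕ) [NeZero L] (k : ℕ) (B : Fld M) :
    ⟪B, B5Eq114Gauss.DeltaK L M k B⟫_ℝ ≤ gamma1 d * (8 * d) * ‖B‖ ^ 2 := by
  have h := (ineq167_DeltaK_sharp L M k B).2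
  have h2 := d1Sq_le M (cplx B)
  rw [sum_norm_sq_cplx] at h2
  calc ⟪B, B5Eq114Gauss.DeltaK L M k B⟫_ℝ ≤ gamma1 d * d1Sq M (cplx B) := h
    _ ≤ gamma1 d * (8 * d * ‖B‖ ^ 2) := mul_le_mul_of_nonneg_left h2 (gamma1_pos d).le
    _ = gamma1 d * (8 * d) * ‖B‖ ^ 2 := by ring

end Torus

/-! ## §4  (2.118) for the concrete `Δ_j` of `tsV1`, and the discharge of `Q_jG_jQ_j* ≥ γ` — (2.120) bounded from above -/

section TwoScale

open B6SectCOperators B6SectCOperators.TwoScaleData B6SectCTwoScaleV1 B6SectCTwoScaleV1Lattice B6Eq2130TwoScaleV1Landau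
  LatticeFieldCalculus B5Eq119TorusBridge B5SectBStatements
open B5Eq117TorusCarriers (Mk tB)
open B5Bounds167Lattice (d1Sq)
open Beta.Ineq167OperatorUpper (gamma1 gamma1_pos)
open B5Eq166GaussDeltaK (ineq167_DeltaK_sharp)

variable {P : Params} {c : ℝ} (hc : c ≠ 0) {j : ℕ} (hj : j + 1 ≤ P.m + P.K) (Λ' : Finset (Site P (j + 1)))
  {w : CIdx j Λ' → ℝ} (hw : ∀ i, 0 < w i)

/-- `‖B‖²` of a unit-lattice field in `ℓ²(T^{(j)})` is `B⬝B`. [folklore] -/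
private theorem norm_toLp_sq (B : VecField P j ℝ) : ‖WithLp.toLp 2 B‖ ^ 2 = B ⬝ᵥ B := by
  rw [← real_inner_self_eq_norm_sq, PiLp.inner_apply, dotProduct]
  exact Finset.sum_congr rfl fun b _ => by simp only [RCLike.inner_apply, conj_trivial]

/-- the transport `tB` to the torus carriers is norm-preserving: `‖B̃‖² = ‖B‖²`. [cite: Balaban1984PropagatorsI, (1.19) p.20] -/
theorem norm_tB_sq (B : VecField P j ℝ) : ‖tB (P := P) (k := j) B‖ ^ 2 = ‖WithLp.toLp 2 B‖ ^ 2 := by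
  rw [← real_inner_self_eq_norm_sq, inner_tB, norm_toLp_sq]

include hc in
/-- `0 < κ = c²/(η^d L^{2j})` (the model normalisation of `tsV1` relative to the (1.21) scalar products). [cite: Balaban1984PropagatorsI, (1.21) p.21] -/
theorem kappa_pos : 0 < c ^ 2 / (eta P.L j ^ P.d * ((P.L : ℝ) ^ j) ^ 2) := by
  exact div_pos (lt_of_le_of_ne (sq_nonneg c) (Ne.symm (pow_ne_zero 2 hc)))
    (mul_pos (eta_pow_pos P j) (pow_pos (pow_pos (Nat.cast_pos.2 P.L_pos) j) 2))

include hc in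
/-- `0 ≤ 8dγ₁κ`. [cite: Balaban1984PropagatorsI, (1.67) p.29] -/
theorem const_nonneg : 0 ≤ c ^ 2 / (eta P.L j ^ P.d * ((P.L : ℝ) ^ j) ^ 2) * (gamma1 P.d * (8 * P.d)) :=
  mul_nonneg (kappa_pos (P := P) hc (j := j)).le (mul_nonneg (gamma1_pos P.d).le (by positivity))

include hc in
/-- `0 < γ = (1 + 8dγ₁κ)⁻¹` (*"positive constants"*). [cite: Balaban1984PropagatorsI, (1.100)–(1.101) p.34] -/
theorem gammaV1_pos : 0 < (1 + c ^ 2 / (eta P.L j ^ P.d * ((P.L : ℝ) ^ j) ^ 2) * (gamma1 P.d * (8 * P.d)))⁻¹ :=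
  inv_pos.mpr (by have := const_nonneg (P := P) hc (j := j); linarith)

include hj hw

/-- **the (2.118) form of `tsV1` IS the B5 owner's Gaussian `Δ_j` of (1.19)/(1.65)/(1.66) on `T^{(j)}`, up to the model normalisation:
`⟨B, Δ_jB⟩_{tsV1} = κ·⟨B̃, Δ_j^{tower}B̃⟩`, `κ = c²/(η^d L^{2j})`** (gen 9 `inner_Δj_eq_DeltaK` + `form_DeltaK_scale` + p16's
`dotProduct_DeltaK_eq_inner_DeltaK`). [cite: Balaban1984PropagatorsII, (2.118) p.243] -/
theorem inner_Δj_eq_tower (B : VecField P j ℝ) :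
    ⟪WithLp.toLp 2 B, (tsV1 hc Λ' w).Δj (WithLp.toLp 2 B)⟫_ℝ =
      c ^ 2 / (eta P.L j ^ P.d * ((P.L : ℝ) ^ j) ^ 2) *
        ⟪tB (P := P) (k := j) B, B5Eq114Gauss.DeltaK P.L (Mk P j) j (tB (P := P) (k := j) B)⟫_ℝ := by
  have hk : j ≤ P.m + P.K := Nat.le_of_succ_le hj
  have hη : 0 < eta P.L j ^ P.d := eta_pow_pos P j
  have hL : 0 < ((P.L : ℝ) ^ j) := pow_pos (Nat.cast_pos.2 P.L_pos) j
  rw [inner_Δj_eq_DeltaK hc hj Λ' hw B, form_DeltaK_scale hk one_pos hc B, ← dotProduct_DeltaK_eq_inner_DeltaK hk B,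
    form_DeltaK_scale hk hη hL.ne' B]
  field_simp

/-- **(2.118) FOR THE CONCRETE TWO-SCALE `Δ_j` of `tsV1`: `κ‖∂₁B‖² ≤ ⟨B, Δ_jB⟩ ≤ κγ₁‖∂₁B‖²`**, `‖∂₁B‖² = ⟨∂₁B, ∂₁B⟩` the unit-lattice curl form
of (1.66)/(1.67) (`…B5Bounds167Lattice.d1Sq` of the transported field), `γ₁ = (π²/4)^{d+2}`, `κ = c²/(η^d L^{2j})` — *"satisfying (1.67)"* via
p21's `ineq167_DeltaK_sharp`. [cite: Balaban1984PropagatorsII, (2.118) p.243] -/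
theorem ineq2118_V1 (B : VecField P j ℝ) :
    c ^ 2 / (eta P.L j ^ P.d * ((P.L : ℝ) ^ j) ^ 2) * d1Sq (Mk P j) (cplx (tB (P := P) (k := j) B))
        ≤ ⟪WithLp.toLp 2 B, (tsV1 hc Λ' w).Δj (WithLp.toLp 2 B)⟫_ℝ ∧
      ⟪WithLp.toLp 2 B, (tsV1 hc Λ' w).Δj (WithLp.toLp 2 B)⟫_ℝ
        ≤ c ^ 2 / (eta P.L j ^ P.d * ((P.L : ℝ) ^ j) ^ 2) * (gamma1 P.d * d1Sq (Mk P j) (cplx (tB (P := P) (k := j) B))) := by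
  rw [inner_Δj_eq_tower hc hj Λ' hw B]
  have hκ := (kappa_pos (P := P) hc (j := j)).le
  have h := ineq167_DeltaK_sharp P.L (Mk P j) j (tB (P := P) (k := j) B)
  exact ⟨mul_le_mul_of_nonneg_left h.1 hκ, mul_le_mul_of_nonneg_left h.2 hκ⟩

/-- **an upper bound of the (2.118) form by `‖B‖²`**: `⟨B, Δ_jB⟩ ≤ 8dγ₁κ‖B‖²` for every `B` on `T^{(j)}`.
[cite: Balaban1984PropagatorsII, (2.118) p.243 + (2.120) p.244] -/
theorem inner_Δj_le_V1 (y : UBond P j) :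
    ⟪y, (tsV1 hc Λ' w).Δj y⟫_ℝ ≤ c ^ 2 / (eta P.L j ^ P.d * ((P.L : ℝ) ^ j) ^ 2) * (gamma1 P.d * (8 * P.d)) * ‖y‖ ^ 2 := by
  have hκ := (kappa_pos (P := P) hc (j := j)).le
  have h := inner_Δj_eq_tower hc hj Λ' hw (WithLp.ofLp y)
  rw [WithLp.toLp_ofLp] at h
  have hn : ‖tB (P := P) (k := j) (WithLp.ofLp y)‖ ^ 2 = ‖y‖ ^ 2 := by rw [norm_tB_sq, WithLp.toLp_ofLp]
  rw [h, ← hn]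
  calc c ^ 2 / (eta P.L j ^ P.d * ((P.L : ℝ) ^ j) ^ 2) *
        ⟪tB (P := P) (k := j) (WithLp.ofLp y), B5Eq114Gauss.DeltaK P.L (Mk P j) j (tB (P := P) (k := j) (WithLp.ofLp y))⟫_ℝ
      ≤ c ^ 2 / (eta P.L j ^ P.d * ((P.L : ℝ) ^ j) ^ 2) * (gamma1 P.d * (8 * P.d) * ‖tB (P := P) (k := j) (WithLp.ofLp y)‖ ^ 2) :=
        mul_le_mul_of_nonneg_left (inner_DeltaK_le_norm_sq (Mk P j) P.L j _) hκ
    _ = _ := by ring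

/-- **`(Q_jG_jQ_j*)⁻¹ ≤ 1 + 8dγ₁κ`**: `⟨B, (Q_jG_jQ_j*)⁻¹B⟩ ≤ (1 + 8dγ₁κ)‖B‖²` (gen 9: `(Q_jG_jQ_j*)⁻¹ = I + Δ_j`).
[cite: Balaban1984PropagatorsII, (2.130) p.246 + (2.118) p.243] -/
theorem inner_Ej_le_V1 (y : UBond P j) :
    ⟪y, (tsV1 hc Λ' w).Ej y⟫_ℝ ≤ (1 + c ^ 2 / (eta P.L j ^ P.d * ((P.L : ℝ) ^ j) ^ 2) * (gamma1 P.d * (8 * P.d))) * ‖y‖ ^ 2 := by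
  rw [add_mul, one_mul]
  linarith [B6Eq2118DeltaJInverse.inner_Δj_eq (isLattice Λ' hc hj hw) (positive Λ' hc hj w) y, inner_Δj_le_V1 hc hj Λ' hw y]

/-- **THE DISCHARGE — [4] p. 34 *"The same property holds for QGQ*"* / (1.100) lower half FOR THE CONCRETE TWO-SCALE OPERATORS of `tsV1`:
`(1 + 8dγ₁κ)⁻¹‖ω‖² ≤ ⟨ω, Q_jG_jQ_j*ω⟩` for every `ω` on `T^{(j)}`** — the displayed hypothesis `hlow` of gen 9's `inner_Sb_le_of_QGQ_ge` /
`inner_Ej_le_of_QGQ_ge` holds for the concrete model (route p. 248: upper bound of the form through (2.118), then §1).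
[cite: Balaban1984PropagatorsI, (1.100)–(1.101) p.34] -/
theorem inner_QGQ_ge_V1 (ω : UBond P j) :
    (1 + c ^ 2 / (eta P.L j ^ P.d * ((P.L : ℝ) ^ j) ^ 2) * (gamma1 P.d * (8 * P.d)))⁻¹ * ‖ω‖ ^ 2 ≤
      ⟪ω, ((tsV1 hc Λ' w).Qv ∘ₗ (tsV1 hc Λ' w).Gj ∘ₗ LinearMap.adjoint (tsV1 hc Λ' w).Qv) ω⟫_ℝ :=
  inner_QGQ_ge_of_Δj_le (isLattice Λ' hc hj hw) (positive Λ' hc hj w) (const_nonneg (P := P) hc (j := j))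
    (inner_Δj_le_V1 hc hj Λ' hw) ω

/-- **p. 244 *"The form is bounded from above"* FOR `tsV1`, WITH NO DISPLAYED HYPOTHESIS**: `⟨B, (Q″*aQ″ + Δ_j)B⟩ ≤ ⟨Q″B, aQ″B⟩ + 8dγ₁κ‖B‖²`
(the `𝔅`-part `⟨Q″B, aQ″B⟩ = ‖B↾_{Λ^c}‖² + L^{−2}‖(Q₁B)↾_{Λ′}‖²`-type term is bounded by the weights; here kept as printed).
[cite: Balaban1984PropagatorsII, (2.120) p.244] -/
theorem inner_Sb_le_V1 (b : UBond P j) :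
    ⟪b, (tsV1 hc Λ' w).Sb b⟫_ℝ ≤ ⟪(tsV1 hc Λ' w).Qpp b, (tsV1 hc Λ' w).a ((tsV1 hc Λ' w).Qpp b)⟫_ℝ
      + c ^ 2 / (eta P.L j ^ P.d * ((P.L : ℝ) ^ j) ^ 2) * (gamma1 P.d * (8 * P.d)) * ‖b‖ ^ 2 := by
  rw [B6Eq2118DeltaJInverse.inner_Sb_eq (isLattice Λ' hc hj hw) (positive Λ' hc hj w)]
  have h := inner_Ej_le_V1 hc hj Λ' hw b
  rw [add_mul, one_mul] at h
  linarith

/-- … the same THROUGH gen 9's reduction, verbatim: `inner_Sb_le_of_QGQ_ge` with its `hlow` fed by `inner_QGQ_ge_V1` (constant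
`γ⁻¹ − 1 = 8dγ₁κ`). [cite: Balaban1984PropagatorsII, (2.120) p.244 + p.248] -/
theorem inner_Sb_le_V1' (b : UBond P j) :
    ⟪b, (tsV1 hc Λ' w).Sb b⟫_ℝ ≤ ⟪(tsV1 hc Λ' w).Qpp b, (tsV1 hc Λ' w).a ((tsV1 hc Λ' w).Qpp b)⟫_ℝ
      + (((1 + c ^ 2 / (eta P.L j ^ P.d * ((P.L : ℝ) ^ j) ^ 2) * (gamma1 P.d * (8 * P.d)))⁻¹)⁻¹ - 1) * ‖b‖ ^ 2 :=
  B6Eq2118DeltaJInverse.inner_Sb_le_of_QGQ_ge (isLattice Λ' hc hj hw) (positive Λ' hc hj w)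
    (gammaV1_pos (P := P) hc (j := j)) (inner_QGQ_ge_V1 hc hj Λ' hw) b

/-! ### At the printed normalisation `c² = η^{d−2}` (`κ = 1`): constants depending on `d` only -/

omit hj hw in
/-- at `c² = η^d·L^{2j}` (`= η^{d−2}`, `η = L^{−j}`: the (1.21) weight `η^d` and the factor `η⁻¹` inside `∂`) the normalisation is `κ = 1`.
[cite: Balaban1984PropagatorsI, (1.21) p.21] -/
theorem kappa_eq_one (hcη : c ^ 2 = eta P.L j ^ P.d * ((P.L : ℝ) ^ j) ^ 2) :
    c ^ 2 / (eta P.L j ^ P.d * ((P.L : ℝ) ^ j) ^ 2) = 1 := by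
  rw [hcη]
  exact div_self (mul_pos (eta_pow_pos P j) (pow_pos (pow_pos (Nat.cast_pos.2 P.L_pos) j) 2)).ne'

/-- **(2.118) for `tsV1` at the printed normalisation: `‖∂₁B‖² ≤ ⟨B, Δ_jB⟩ ≤ γ₁‖∂₁B‖²`**, `γ₀ = 1`, `γ₁ = (π²/4)^{d+2}` depending on `d` only
(*"satisfying (1.67)"*). [cite: Balaban1984PropagatorsII, (2.118) p.243] -/
theorem ineq2118_V1_printed (hcη : c ^ 2 = eta P.L j ^ P.d * ((P.L : ℝ) ^ j) ^ 2) (B : VecField P j ℝ) :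
    d1Sq (Mk P j) (cplx (tB (P := P) (k := j) B)) ≤ ⟪WithLp.toLp 2 B, (tsV1 hc Λ' w).Δj (WithLp.toLp 2 B)⟫_ℝ ∧
      ⟪WithLp.toLp 2 B, (tsV1 hc Λ' w).Δj (WithLp.toLp 2 B)⟫_ℝ ≤ gamma1 P.d * d1Sq (Mk P j) (cplx (tB (P := P) (k := j) B)) := by
  have h := ineq2118_V1 hc hj Λ' hw B
  rw [kappa_eq_one hcη, one_mul, one_mul] at h
  exact h

/-- **[4] p. 34 / [B6] p. 246 for `tsV1` at the printed normalisation: `(1 + 8dγ₁)⁻¹‖ω‖² ≤ ⟨ω, Q_jG_jQ_j*ω⟩`** — a constant depending on `d`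
only, uniform in `j`, `L`, the volume and `Λ′`. [cite: Balaban1984PropagatorsI, (1.100)–(1.101) p.34] -/
theorem inner_QGQ_ge_V1_printed (hcη : c ^ 2 = eta P.L j ^ P.d * ((P.L : ℝ) ^ j) ^ 2) (ω : UBond P j) :
    (1 + gamma1 P.d * (8 * P.d))⁻¹ * ‖ω‖ ^ 2 ≤
      ⟪ω, ((tsV1 hc Λ' w).Qv ∘ₗ (tsV1 hc Λ' w).Gj ∘ₗ LinearMap.adjoint (tsV1 hc Λ' w).Qv) ω⟫_ℝ := by
  have h := inner_QGQ_ge_V1 hc hj Λ' hw ω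
  rw [kappa_eq_one hcη, one_mul] at h
  exact h

/-- **p. 244 *"The form is bounded from above"* for `tsV1` at the printed normalisation: `⟨B, (Q″*aQ″ + Δ_j)B⟩ ≤ ⟨Q″B, aQ″B⟩ + 8dγ₁‖B‖²`.**
[cite: Balaban1984PropagatorsII, (2.120) p.244] -/
theorem inner_Sb_le_V1_printed (hcη : c ^ 2 = eta P.L j ^ P.d * ((P.L : ℝ) ^ j) ^ 2) (b : UBond P j) :
    ⟪b, (tsV1 hc Λ' w).Sb b⟫_ℝ ≤ ⟪(tsV1 hc Λ' w).Qpp b, (tsV1 hc Λ' w).a ((tsV1 hc Λ' w).Qpp b)⟫_ℝ + gamma1 P.d * (8 * P.d) * ‖b‖ ^ 2 := by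
  have h := inner_Sb_le_V1 hc hj Λ' hw b
  rw [kappa_eq_one hcη, one_mul] at h
  exact h

end TwoScale

end Literature.MathematicalPhysics.QuantumFieldTheory.Balaban1983to89.B6Ineq2118TwoScaleV1

end
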